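import Mathlib
import Literature.AlgebraicGeometry.Resolution.CobordantGame
import Summits.ResolutionOfSingularities.ResolutionOfSingularities.Theorems.WeightedInvariantLocalWeightedDropGradedSliceWildTrivialization

/-!
# `WeightedInvariant.LocalWeightedDrop`: the WILD SLICE, part 2 — `Λ_q` is a graded coordinate change; T3″ HOLDS ON THE FROBENIUS
# COVER; the wild slice clause reduces to ONE descent step

Route `ResolutionOfSingularities/WeightedInvariant`, crux `LocalWeightedDrop` (stmt-ResolutionOfSingularities-8899).
[OURS · L1 W4.3] — graded-slice package of res-type-060 (res-L1-w43-plan-1 DEALS gen 9 #11 (1) «the wild clause»); continuation of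
`…GradedSliceWildTrivialization` (the identity `g(Λ_q(s, y', y_v^q)) = (1+y_v)ᵃ · ((g|_{v=0}) ⊗ 1)(Tw_q)` at a frozen coordinate `v`
= last of MINIMAL `p`-adic valuation among the translated coordinates).  Nothing here is a statement of the manuscript under review on
ladder RESOLUTION; OURS statements about the graded game of ideator res-L1-w43-idea-1's line; not a verdict on card A.  AI proof,
weaker than expert review.

* §3 `wildLambda_graded` (graded for every lattice containing `e_v` and the translated unit vectors — e.g. the propagated lattice),
  `det_linMat_wildLambda` (`det = c_v·⌈w_v/q⌉`, upper triangular), `gradedWonBy_of_subst_wildLambda` (transfer back along `Λ_q`).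
* §4 **`gradedWonBy_wildLambdaFrob_of_slice` — T3″ HOLDS ON THE FROBENIUS COVER** (every field, lattice, rank): slice `g|_{y_v=0}`
  graded-won with rank `α` for the slice lattice ⇒ the Frobenius pull-back `g(Λ_q(s, y', y_v^q))` graded-won with rank `α` for the
  propagated lattice `succLattice L w c` (cylinder p511529 + lattice comparison + coordinate change p512731 + unit p512265).
  **`gradedWonBy_of_slice_wild_of_descent`** — idea-1's wild stub (minimal-valuation form) FOLLOWS from the single descent step
  «graded win of `G(s, y', y_v^q)` ⇒ graded win of `G`, same rank» for the renormalised successor `G = g(Λ_q)`.  General Frobenius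
  descent of graded wins is NOT claimed — it FAILS (`s² + y³z²` pulls back along `y ↦ y²` to the square of a smooth germ; res-type-099)
  — and whether it holds for these twisted cylinders `G = Σ_d (1+y_v)^{d/q}·h^{[d]}` (`h = Σ_d h^{[d]}` the weight decomposition of the
  slice, `s ↦ 1`, untranslated `yⱼ ↦ −wⱼ`, translated `↦ 0`, all `d ≡ 0 mod q`) IS the open wild clause.
  Memo: HOME/L/res-type-060-w43/WILD-SLICE-CLAUSE.md.
-/

set_option linter.dupNamespace false -- mandated namespace of this single-conjunct summit
set_option autoImplicit false

namespace Summit.ResolutionOfSingularities.ResolutionOfSingularities.Theorems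

namespace GradedGame

open MvPowerSeries
open Literature.AlgebraicGeometry.Resolution
open Literature.AlgebraicGeometry.Resolution.FormalCoordChange (linMat exists_comp_inverse)

variable {k : Type} [Field k]

/-! ## §3 `Λ_q` is a graded coordinate change: degrees and determinant -/

section LambdaProps

variable {n : ℕ} (w : Fin (n + 1) → ℕ) (c : Fin (n + 1) → k) (q : ℕ)

/-- `⌈0/q⌉ = 0`. [OURS · L1 W4.3] -/
theorem ceilExp_eq_zero_of_eq_zero (j : Fin (n + 1)) (hw0 : w j = 0) : ceilExp w q j = 0 := by
  unfold ceilExp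
  rw [hw0, zero_add]
  rcases Nat.eq_zero_or_pos q with hq | hq
  · subst hq; simp
  · exact Nat.div_eq_of_lt (by omega)

/-- **`Λ_q` IS GRADED** for every lattice containing `e_v` (the frozen coordinate) and the unit vectors of the translated
coordinates — in particular for the propagated lattice `succLattice L w c` when `c_v ≠ 0 < w_v`. [OURS · L1 W4.3] -/
theorem wildLambda_graded (Lt : AddSubgroup (Fin (n + 1 + 1) → ℤ))
    (hlast : (Pi.single (Fin.last (n + 1)) 1 : Fin (n + 1 + 1) → ℤ) ∈ Lt)
    (hgen : ∀ j : Fin (n + 1), c j ≠ 0 → 0 < w j → (Pi.single j.succ 1 : Fin (n + 1 + 1) → ℤ) ∈ Lt)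
    (i : Fin (n + 1 + 1)) (e : Fin (n + 1 + 1) →₀ ℕ) (he : coeff e (wildLambda w c q i) ≠ 0) :
    expVec e - Pi.single i 1 ∈ Lt := by
  have he0 : e ≠ 0 := by
    rintro rfl
    exact he (by rw [coeff_zero_eq_constantCoeff_apply]; exact constantCoeff_wildLambda w c q i)
  revert he
  refine Fin.cases ?_ (fun j => ?_) i
  · intro he
    rw [wildLambda_zero] at he
    exact homDeg_X Lt 0 e he
  · intro he
    rw [wildLambda_succ] at he
    have hP := homDeg_one_add_X_pow (k := k) Lt (Fin.last (n + 1)) hlast (ceilExp w q j)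
    have hCz : coeff e (C (c j) : MvPowerSeries (Fin (n + 1 + 1)) k) = 0 := by rw [coeff_C, if_neg he0]
    by_cases hj : j = Fin.last n
    · rw [if_pos hj] at he
      rcases coeff_ne_zero_or_of_sub he with h1 | h1
      · rw [coeff_C_mul] at h1
        have hPe : coeff e ((1 + X (Fin.last (n + 1))) ^ (ceilExp w q j) : MvPowerSeries (Fin (n + 1 + 1)) k) ≠ 0 :=
          right_ne_zero_of_mul h1
        have hd := hP e hPe
        have hL : (Pi.single j.succ 1 : Fin (n + 1 + 1) → ℤ) ∈ Lt := by rw [hj, Fin.succ_last]; exact hlast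
        have : expVec e - Pi.single j.succ 1 = (expVec e - 0) - Pi.single j.succ 1 := by rw [sub_zero]
        rw [this]
        exact Lt.sub_mem hd hL
      · exact absurd hCz h1
    · rw [if_neg hj] at he
      by_cases hw0 : w j = 0
      · rw [ceilExp_eq_zero_of_eq_zero w q j hw0, pow_zero, one_mul, add_sub_cancel_left] at he
        exact homDeg_X Lt j.succ e he
      · rcases coeff_ne_zero_or_of_sub he with h1 | h1
        · by_cases hcj : c j = 0
          · rw [hcj, map_zero, zero_add] at h1
            have := homDeg_mul Lt hP (homDeg_X Lt j.succ) e h1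
            rwa [zero_add] at this
          · have hjs := hgen j hcj (Nat.pos_of_ne_zero hw0)
            have := homDeg_mul Lt hP (homDeg_C_add_X Lt j.succ hjs (c j)) e h1
            rw [add_zero] at this
            have hsplit : expVec e - Pi.single j.succ 1 = (expVec e - 0) - Pi.single j.succ 1 := by rw [sub_zero]
            rw [hsplit]
            exact Lt.sub_mem this hjs
        · exact absurd hCz h1

/-- Row `0` of the linear part of `Λ_q`. [OURS · L1 W4.3] -/
theorem linMat_wildLambda_zero (j : Fin (n + 1 + 1)) : linMat (wildLambda w c q) 0 j = if j = 0 then 1 else 0 := by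
  show coeff (Finsupp.single j 1) (wildLambda w c q 0) = _
  rw [wildLambda_zero, coeff_X]
  by_cases hj : j = 0
  · subst hj; simp
  · rw [if_neg (fun h => hj ((Finsupp.single_left_inj one_ne_zero).mp h)), if_neg hj]

/-- Rows of the linear part of `Λ_q` (coordinates `≠ v`). [OURS · L1 W4.3] -/
theorem linMat_wildLambda_succ (l : Fin (n + 1)) (hl : l ≠ Fin.last n) (j : Fin (n + 1 + 1)) :
    linMat (wildLambda w c q) l.succ j =
      (if j = l.succ then 1 else 0) + (if j = Fin.last (n + 1) then (ceilExp w q l : k) * c l else 0) := by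
  show coeff (Finsupp.single j 1) (wildLambda w c q l.succ) = _
  rw [wildLambda_succ, if_neg hl, mul_add, add_sub_right_comm, map_add, map_sub, coeff_mul_C, coeff_C,
    if_neg (Finsupp.single_ne_zero.mpr one_ne_zero), sub_zero, coeff_single_one_add_X_pow, mul_comm ((1 + X _) ^ _) (X _),
    coeff_single_X_mul, constantCoeff_one_add_X_pow]
  by_cases hj : j = Fin.last (n + 1)
  · rw [hj]; split_ifs <;> ring
  · simp [hj]

/-- Row of the frozen coordinate. [OURS · L1 W4.3] -/
theorem linMat_wildLambda_last (j : Fin (n + 1 + 1)) :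
    linMat (wildLambda w c q) (Fin.last (n + 1)) j =
      if j = Fin.last (n + 1) then c (Fin.last n) * (ceilExp w q (Fin.last n) : k) else 0 := by
  show coeff (Finsupp.single j 1) (wildLambda w c q (Fin.last (n + 1))) = _
  rw [← Fin.succ_last, wildLambda_succ, if_pos rfl, map_sub, coeff_C_mul, coeff_C,
    if_neg (Finsupp.single_ne_zero.mpr one_ne_zero), sub_zero, coeff_single_one_add_X_pow, Fin.succ_last]
  by_cases hj : j = Fin.last (n + 1)
  · simp [hj]
  · simp [hj]

/-- **THE DETERMINANT OF `Λ_q` IS `c_v · ⌈w_v/q⌉`** (`= c_v · w_v/q` when `q ∣ w_v`; upper triangular). [OURS · L1 W4.3] -/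
theorem det_linMat_wildLambda : (linMat (wildLambda w c q)).det = c (Fin.last n) * (ceilExp w q (Fin.last n) : k) := by
  have htri : Matrix.BlockTriangular (linMat (wildLambda w c q)) id := by
    intro i j hij
    simp only [id] at hij
    revert hij
    refine Fin.cases ?_ (fun l => ?_) i
    · intro hij; exact absurd hij (Fin.not_lt_zero j)
    · intro hij
      by_cases hl : l = Fin.last n
      · subst hl
        rw [Fin.succ_last] at hij ⊢
        rw [linMat_wildLambda_last, if_neg hij.ne]
      · rw [linMat_wildLambda_succ w c q l hl, if_neg hij.ne, if_neg, add_zero]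
        exact (lt_of_lt_of_le hij (Fin.le_last _)).ne
  rw [Matrix.det_of_upperTriangular htri, Fin.prod_univ_succ, linMat_wildLambda_zero, if_pos rfl, one_mul,
    Fin.prod_univ_castSucc]
  have h1 : ∀ l : Fin n, linMat (wildLambda w c q) (Fin.castSucc l).succ (Fin.castSucc l).succ = 1 := by
    intro l
    rw [linMat_wildLambda_succ w c q (Fin.castSucc l) (Fin.castSucc_lt_last l).ne, if_pos rfl, if_neg, add_zero]
    rw [← Fin.succ_last]
    exact fun h => (Fin.castSucc_lt_last l).ne (Fin.succ_injective _ h)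
  rw [Finset.prod_eq_one (fun l _ => h1 l), one_mul, Fin.succ_last, linMat_wildLambda_last, if_pos rfl]

/-- TRANSFER BACK ALONG `Λ_q`: a graded win of `f(Λ_q)` is a graded win of `f` (formal inverse of the graded invertible `Λ_q`).
[OURS · L1 W4.3] -/
theorem gradedWonBy_of_subst_wildLambda (α : Ordinal.{0}) (Lt : AddSubgroup (Fin (n + 1 + 1) → ℤ))
    (hlast : (Pi.single (Fin.last (n + 1)) 1 : Fin (n + 1 + 1) → ℤ) ∈ Lt)
    (hgen : ∀ j : Fin (n + 1), c j ≠ 0 → 0 < w j → (Pi.single j.succ 1 : Fin (n + 1 + 1) → ℤ) ∈ Lt)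
    (hc : c (Fin.last n) ≠ 0) (hE : ((ceilExp w q (Fin.last n) : ℕ) : k) ≠ 0) (f : MvPowerSeries (Fin (n + 1 + 1)) k) :
    GradedWonBy α (n + 1 + 1) Lt (subst (wildLambda w c q) f) → GradedWonBy α (n + 1 + 1) Lt f := by
  intro h
  have hΛ0 := constantCoeff_wildLambda w c q
  have hΛdet : IsUnit (linMat (wildLambda w c q)).det := by
    rw [det_linMat_wildLambda]; exact isUnit_iff_ne_zero.mpr (mul_ne_zero hc hE)
  obtain ⟨Ψ, hΨ0, hΨ1, hΨ2⟩ := exists_comp_inverse hΛ0 hΛdet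
  have hΛs : HasSubst (wildLambda w c q) := hasSubst_of_constantCoeff_zero hΛ0
  have hΨs : HasSubst Ψ := hasSubst_of_constantCoeff_zero hΨ0
  have h5 := gradedWonBy_subst_of_leftInverse α Lt (subst (wildLambda w c q) f) Ψ (wildLambda w c q) hΨ0 hΛ0 hΛdet
    (wildLambda_graded w c q Lt hlast hgen) hΨ2 h
  have hback : subst Ψ (subst (wildLambda w c q) f) = f := by
    rw [subst_comp_subst_apply hΛs hΨs]
    have : (fun j => subst Ψ (wildLambda w c q j)) = X := by funext j; exact hΨ1 j
    rw [this, subst_self]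
    rfl
  rwa [hback] at h5

end LambdaProps

/-! ## §4 T3″ ON THE FROBENIUS COVER, and the reduction of the wild slice clause to a descent step -/

section Game

variable {n : ℕ} (w : Fin (n + 1) → ℕ) (c : Fin (n + 1) → k) (q : ℕ)

/-- **T3″ HOLDS ON THE FROBENIUS COVER (every field, every lattice, every rank).**  At a frozen coordinate `v` = last with
`c_v ≠ 0 < w_v`, `q ∣ w_v` and `q ∣ wⱼ` for every translated `j` (e.g. `q = p^{e}` with `e = min v_p(wⱼ)` over the
translated coordinates — `v` of MINIMAL `p`-adic valuation; `q = 1` is the tame case), in any ring with `(1+y_v)^q = 1 + y_v^q`: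
if the slice `g|_{y_v=0}` is won with rank `α` in the graded game of the slice lattice, then the Frobenius pull-back
`g(Λ_q(s, y', y_v^q))` of the renormalised successor is won with rank `α` in the graded game of the propagated lattice
`succLattice L w c`.  Proof: the wild trivialization identity + cylinder lemma (p511529) + lattice comparison + coordinate
change transfer along `Tw_q` (p512731) + unit transfer (p512265). [OURS · L1 W4.3] -/
theorem gradedWonBy_wildLambdaFrob_of_slice (α : Ordinal.{0}) (L : AddSubgroup (Fin (n + 1) → ℤ)) (hq : 0 < q)
    (hfrob : ((1 : MvPowerSeries (Fin (n + 1 + 1)) k) + X (Fin.last (n + 1))) ^ q = 1 + X (Fin.last (n + 1)) ^ q)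
    (F' : MvPowerSeries (Fin (n + 1)) k) (a : ℕ) (g : MvPowerSeries (Fin (n + 1 + 1)) k)
    (hfac : subst (CobordantGame.cruxChart k w c) F' = X 0 ^ a * g)
    (hc : c (Fin.last n) ≠ 0) (hw : 0 < w (Fin.last n)) (hv : q ∣ w (Fin.last n))
    (hmin : ∀ j, j ≠ Fin.last n → c j ≠ 0 → q ∣ w j) :
    GradedWonBy α (n + 1) (sliceLattice (succLattice L w c) (Fin.last n)) (sliceGerm (Fin.last n) g) →
      GradedWonBy α (n + 1 + 1) (succLattice L w c) (subst (wildLambdaFrob w c q) g) := by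
  classical
  intro hh
  set L' := succLattice L w c with hL'
  have hgen : ∀ j : Fin (n + 1), c j ≠ 0 → 0 < w j → (Pi.single j.succ 1 : Fin (n + 1 + 1) → ℤ) ∈ L' :=
    fun j hcj hwj => AddSubgroup.subset_closure (Or.inr ⟨j, hcj, hwj, rfl⟩)
  have hlast : (Pi.single (Fin.last (n + 1)) 1 : Fin (n + 1 + 1) → ℤ) ∈ L' := by
    rw [← Fin.succ_last]; exact hgen _ hc hw
  obtain ⟨w', hw1, hw0, hws⟩ := exists_inv_one_add_X (k := k) (Fin.last (n + 1))
  have hw'deg : ∀ d, coeff d w' ≠ 0 → expVec d - 0 ∈ L' := by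
    intro d hd
    obtain ⟨t, rfl⟩ := hws d hd
    rw [expVec_single, sub_zero]
    have : (Pi.single (Fin.last (n + 1)) (t : ℤ) : Fin (n + 1 + 1) → ℤ) = t • (Pi.single (Fin.last (n + 1)) 1 : Fin (n + 1 + 1) → ℤ) := by
      funext x
      by_cases hx : x = Fin.last (n + 1)
      · subst hx; simp
      · simp [hx]
    rw [this]
    exact L'.nsmul_mem hlast t
  -- the inverse scaling `Tw'_q = (s·w', (w'^{resExp j} yⱼ)ⱼ)`
  set Tw' : Fin (n + 1 + 1) → MvPowerSeries (Fin (n + 1 + 1)) k :=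
    Fin.cases (X 0 * w') (fun j => w' ^ (resExp w q j) * X j.succ) with hTw'
  have hTw'zero : Tw' 0 = X 0 * w' := by simp [hTw']
  have hTw'succ : ∀ j : Fin (n + 1), Tw' j.succ = w' ^ (resExp w q j) * X j.succ := by
    intro j; simp only [hTw', Fin.cases_succ]
  have hres0 : resExp w q (Fin.last n) = 0 := resExp_eq_zero_of_dvd w q hq _ hv
  have hTw'last : Tw' (Fin.last (n + 1)) = X (Fin.last (n + 1)) := by
    rw [← Fin.succ_last, hTw'succ, hres0, pow_zero, one_mul]
  have hTw'0 : ∀ j, constantCoeff (Tw' j) = 0 := by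
    intro j
    refine Fin.cases ?_ (fun l => ?_) j
    · rw [hTw'zero]; simp [constantCoeff_X]
    · rw [hTw'succ]; simp [constantCoeff_X]
  have hTw's : HasSubst Tw' := hasSubst_of_constantCoeff_zero hTw'0
  have hM : (Matrix.of fun i j => coeff (Finsupp.single j 1) (Tw' i)) = 1 := by
    ext i j
    rw [Matrix.of_apply, Matrix.one_apply]
    induction i using Fin.cases with
    | zero =>
      rw [hTw'zero, coeff_single_X_mul, hw0]
      by_cases hj : j = 0
      · subst hj; simp
      · simp [hj, Ne.symm hj]
    | succ l =>
      rw [hTw'succ, mul_comm, coeff_single_X_mul, map_pow, hw0, one_pow]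
      by_cases hj : j = l.succ
      · subst hj; simp
      · simp [hj, Ne.symm hj]
  have hTw'det : IsUnit (linMat Tw').det := by
    change IsUnit (Matrix.of fun i j => coeff (Finsupp.single j 1) (Tw' i)).det
    rw [hM, Matrix.det_one]
    exact isUnit_one
  have hTw'gr : ∀ j (e : Fin (n + 1 + 1) →₀ ℕ), coeff e (Tw' j) ≠ 0 → expVec e - Pi.single j 1 ∈ L' := by
    intro j e he
    revert he
    refine Fin.cases ?_ (fun l => ?_) j
    · intro he
      rw [hTw'zero] at he
      have h := homDeg_mul L' (homDeg_X L' 0) hw'deg e he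
      rwa [add_zero] at h
    · intro he
      rw [hTw'succ] at he
      have h := homDeg_mul L' (homDeg_pow L' hw'deg (resExp w q l)) (homDeg_X L' l.succ) e he
      rwa [smul_zero, zero_add] at h
  have h1s : subst Tw' (1 : MvPowerSeries (Fin (n + 1 + 1)) k) = 1 := by rw [← coe_substAlgHom hTw's, map_one]
  have hTwinv : ∀ j, subst Tw' (wildTw (k := k) w q j) = X j := by
    intro j
    refine Fin.cases ?_ (fun l => ?_) j
    · rw [wildTw_zero, subst_mul hTw's, subst_add hTw's, h1s, subst_X hTw's, subst_X hTw's, hTw'last, hTw'zero]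
      calc (1 + X (Fin.last (n + 1))) * (X 0 * w') = X 0 * (w' * (1 + X (Fin.last (n + 1)))) := by ring
        _ = X 0 := by rw [hw1, mul_one]
    · rw [wildTw_succ, subst_mul hTw's, subst_pow hTw's, subst_add hTw's, h1s, subst_X hTw's, subst_X hTw's, hTw'last,
        hTw'succ, ← mul_assoc, ← mul_pow, mul_comm (1 + X _) w', hw1, one_pow, one_mul]
  -- assemble
  have h1 := gradedWonBy_cylinder α _ _ hh
  have h2 : GradedWonBy α (n + 1 + 1) L' (cylinder (sliceGerm (Fin.last n) g)) :=
    GradedWonBy.mono_lattice α (cylLattice_sliceLattice_last_le L' hlast) h1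
  have h3 := gradedWonBy_subst_of_leftInverse α L' _ (wildTw w q) Tw' (constantCoeff_wildTw w q) hTw'0 hTw'det hTw'gr hTwinv h2
  have hunit : IsUnit ((1 + X (Fin.last (n + 1))) ^ a : MvPowerSeries (Fin (n + 1 + 1)) k) :=
    (IsUnit.of_mul_eq_one w' (by rw [mul_comm]; exact hw1)).pow a
  have h4 := gradedWonBy_unit_mul α L' _ _ hunit h3
  rw [← subst_wildLambdaFrob_eq w c q hq hfrob hw hv hmin F' a g hfac] at h4
  exact h4

/-- `g(Λ_q ∘ Frob) = (g(Λ_q))(Frob)`: the Frobenius pull-back of the renormalised successor. [OURS · L1 W4.3] -/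
theorem subst_wildLambdaFrob (hq : 0 < q) (g : MvPowerSeries (Fin (n + 1 + 1)) k) :
    subst (wildLambdaFrob w c q) g = subst (frobFamily (k := k) n q) (subst (wildLambda w c q) g) := by
  rw [subst_comp_subst_apply (hasSubst_wildLambda w c q) (hasSubst_frobFamily (n := n) q hq)]
  congr 1
  funext i
  exact wildLambdaFrob_eq_subst w c q hq i

/-- **THE WILD SLICE CLAUSE REDUCED TO A DESCENT STEP.**  Under the hypotheses of `gradedWonBy_wildLambdaFrob_of_slice` plus
`(w_v/q : k) ≠ 0` (so that `Λ_q` is invertible; automatic for `q = p^{v_p(w_v)}`), the one-sided slice transfer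
«slice graded-won with rank `α` ⇒ successor graded-won with rank `α`» at the wild point FOLLOWS from the single descent
statement `hdesc`: a graded win of the Frobenius pull-back `G(s, y', y_v^q)` of the renormalised successor `G = g(Λ_q)`
is a graded win of `G` itself, with the same rank.  (General Frobenius descent of graded wins is NOT claimed — it fails
for `s² + y³z²`, whose pull-back along `y ↦ y²` is a smooth square, res-type-099 — only this instance is what the
clause needs.) [OURS · L1 W4.3] -/
theorem gradedWonBy_of_slice_wild_of_descent (α : Ordinal.{0}) (L : AddSubgroup (Fin (n + 1) → ℤ)) (hq : 0 < q)
    (hfrob : ((1 : MvPowerSeries (Fin (n + 1 + 1)) k) + X (Fin.last (n + 1))) ^ q = 1 + X (Fin.last (n + 1)) ^ q)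
    (F' : MvPowerSeries (Fin (n + 1)) k) (a : ℕ) (g : MvPowerSeries (Fin (n + 1 + 1)) k)
    (hfac : subst (CobordantGame.cruxChart k w c) F' = X 0 ^ a * g)
    (hc : c (Fin.last n) ≠ 0) (hw : 0 < w (Fin.last n)) (hv : q ∣ w (Fin.last n))
    (hmin : ∀ j, j ≠ Fin.last n → c j ≠ 0 → q ∣ w j) (hE : ((ceilExp w q (Fin.last n) : ℕ) : k) ≠ 0)
    (hdesc : GradedWonBy α (n + 1 + 1) (succLattice L w c) (subst (frobFamily (k := k) n q) (subst (wildLambda w c q) g)) →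
      GradedWonBy α (n + 1 + 1) (succLattice L w c) (subst (wildLambda w c q) g)) :
    GradedWonBy α (n + 1) (sliceLattice (succLattice L w c) (Fin.last n)) (sliceGerm (Fin.last n) g) →
      GradedWonBy α (n + 1 + 1) (succLattice L w c) g := by
  intro hh
  have hgen : ∀ j : Fin (n + 1), c j ≠ 0 → 0 < w j → (Pi.single j.succ 1 : Fin (n + 1 + 1) → ℤ) ∈ succLattice L w c :=
    fun j hcj hwj => AddSubgroup.subset_closure (Or.inr ⟨j, hcj, hwj, rfl⟩)
  have hlast : (Pi.single (Fin.last (n + 1)) 1 : Fin (n + 1 + 1) → ℤ) ∈ succLattice L w c := by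
    rw [← Fin.succ_last]; exact hgen _ hc hw
  have h1 := gradedWonBy_wildLambdaFrob_of_slice w c q α L hq hfrob F' a g hfac hc hw hv hmin hh
  rw [subst_wildLambdaFrob w c q hq] at h1
  exact gradedWonBy_of_subst_wildLambda w c q α (succLattice L w c) hlast hgen hc hE g (hdesc h1)

/-- **RANK-FREE FORM** (what the composition `localWeightedDrop_of_graded` actually consumes — existence of a graded win): under the
same hypotheses, the rank-free one-sided wild slice transfer «slice graded-won ⇒ successor graded-won» FOLLOWS from RANK-FREE descent
for the renormalised successor `G = g(Λ_q)`: «`G(s, y', y_v^q)` graded-won ⇒ `G` graded-won».  (res-type-099's `s² + y³z²` is no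
objection to the rank-free form.) [OURS · L1 W4.3] -/
theorem exists_gradedWonBy_of_slice_wild_of_descent (L : AddSubgroup (Fin (n + 1) → ℤ)) (hq : 0 < q)
    (hfrob : ((1 : MvPowerSeries (Fin (n + 1 + 1)) k) + X (Fin.last (n + 1))) ^ q = 1 + X (Fin.last (n + 1)) ^ q)
    (F' : MvPowerSeries (Fin (n + 1)) k) (a : ℕ) (g : MvPowerSeries (Fin (n + 1 + 1)) k)
    (hfac : subst (CobordantGame.cruxChart k w c) F' = X 0 ^ a * g)
    (hc : c (Fin.last n) ≠ 0) (hw : 0 < w (Fin.last n)) (hv : q ∣ w (Fin.last n))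
    (hmin : ∀ j, j ≠ Fin.last n → c j ≠ 0 → q ∣ w j) (hE : ((ceilExp w q (Fin.last n) : ℕ) : k) ≠ 0)
    (hdesc : (∃ α : Ordinal.{0}, GradedWonBy α (n + 1 + 1) (succLattice L w c)
        (subst (frobFamily (k := k) n q) (subst (wildLambda w c q) g))) →
      ∃ β : Ordinal.{0}, GradedWonBy β (n + 1 + 1) (succLattice L w c) (subst (wildLambda w c q) g)) :
    (∃ α : Ordinal.{0}, GradedWonBy α (n + 1) (sliceLattice (succLattice L w c) (Fin.last n)) (sliceGerm (Fin.last n) g)) →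
      ∃ β : Ordinal.{0}, GradedWonBy β (n + 1 + 1) (succLattice L w c) g := by
  rintro ⟨α, hh⟩
  have hgen : ∀ j : Fin (n + 1), c j ≠ 0 → 0 < w j → (Pi.single j.succ 1 : Fin (n + 1 + 1) → ℤ) ∈ succLattice L w c :=
    fun j hcj hwj => AddSubgroup.subset_closure (Or.inr ⟨j, hcj, hwj, rfl⟩)
  have hlast : (Pi.single (Fin.last (n + 1)) 1 : Fin (n + 1 + 1) → ℤ) ∈ succLattice L w c := by
    rw [← Fin.succ_last]; exact hgen _ hc hw
  have h1 := gradedWonBy_wildLambdaFrob_of_slice w c q α L hq hfrob F' a g hfac hc hw hv hmin hh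
  rw [subst_wildLambdaFrob w c q hq] at h1
  obtain ⟨β, hβ⟩ := hdesc ⟨α, h1⟩
  exact ⟨β, gradedWonBy_of_subst_wildLambda w c q β (succLattice L w c) hlast hgen hc hE g hβ⟩

end Game

end GradedGame

end Summit.ResolutionOfSingularities.ResolutionOfSingularities.Theorems
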